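import Mathlib
import Summits.ValiantsHypothesis.ValiantsHypothesis.Theorems.NewtonUnitEquationsNewtonTauWeakAutomatonDefs

/-!
# `NewtonUnitEquationsNewtonTauWeakAutomatonCoeff` — carry automaton: correctness of the transfer matrices

Rung toward `stub_binomialNewtonTauCommon` (crux `NewtonTauWeak`, stmt-ValiantsHypothesis-5904), line
`binomial-normal-form`, CARRY-AUTOMATON rung: registered stub `stub_autoCoeff`.

Claim.  The coefficient of `x^p y^q` in the digit-hexagon product
`hexProd a b g n = Π_{i<n} (1 - a_i x^{2^i}) (1 - b_i y^{2^i}) (1 - g_i (xy)^{2^i})` is, for `p, q < 2^{n+1}`, the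
`((0,0), (p_n, q_n))` entry of the ordered product `hexN a b g 0 n (p, q)` of the carry transfer matrices
`hexT (a i) (b i) (g i) p_i q_i`, `i < n` (`p_i` = binary digit `i` of `p`), and `0` otherwise.

Proof.  Induction on `n` (for all `p, q`).  `n = 0`: both sides are `[p = q = 0]`.  Step `n → n+1`: peel the top
factor (`Finset.prod_range_succ`) and the top transfer matrix (`List.range'_concat`); expand the top factor into its
`8` monomials `c_u · x^{2^n (u₁+u₃)} y^{2^n (u₂+u₃)}`, `u ∈ {0,1}³` (`hexFactor_expand`); the coefficient of a product
with a monomial is a shifted coefficient (`MvPolynomial.coeff_mul_monomial'`), to which the induction hypothesis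
applies.  The digit bookkeeping (`digit_iff`): for `p < 2^{n+2}` and `κ ∈ {0,1}`,
`2^n v ≤ p ∧ p - 2^n v < 2^{n+1} ∧ bit_n (p - 2^n v) = κ  ↔  v + κ = p_n + 2 p_{n+1}`, which is exactly the
transition rule of `hexT` (incoming carry `κ` = carry out of the low `n` levels, outgoing carry = `p_{n+1}`); and the
low product `hexN a b g 0 n` only reads the digits below `n` (`hexN_congr`). [folklore: carry automaton /
transfer matrices of digit expansions]
-/

set_option linter.dupNamespace false

noncomputable section

open scoped BigOperators
open MvPolynomial

namespace Summit.ValiantsHypothesis.ValiantsHypothesis.Theorems.NewtonTauWeakAutomaton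

namespace AutoCoeffAux

/-! ## Peeling the top level -/

/-- `hexProd` with one more level: the top factor splits off. -/
theorem hexProd_succ (a b g : ℕ → ℂ) (n : ℕ) :
    hexProd a b g (n + 1) = hexProd a b g n * hexFactor (a n) (b n) (g n) n := by
  unfold hexProd
  rw [Finset.prod_range_succ]

/-- `hexN` over the levels `[0, n+1)`: the top transfer matrix splits off on the right. -/
theorem hexN_succ (a b g : ℕ → ℂ) (n p q : ℕ) :
    hexN a b g 0 (n + 1) (p, q) =
      hexN a b g 0 n (p, q) * hexT (a n) (b n) (g n) (p.testBit n).toNat (q.testBit n).toNat := by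
  unfold hexN
  rw [List.range'_concat, List.map_append, List.prod_append, List.map_singleton, List.prod_singleton]
  simp

/-- `hexN a b g 0 n P` only depends on the binary digits of `P` below `n`. -/
theorem hexN_congr (a b g : ℕ → ℂ) (n : ℕ) (P P' : ℕ × ℕ) (h1 : P.1 % 2 ^ n = P'.1 % 2 ^ n)
    (h2 : P.2 % 2 ^ n = P'.2 % 2 ^ n) : hexN a b g 0 n P = hexN a b g 0 n P' := by
  unfold hexN
  congr 1
  apply List.map_congr_left
  intro i hi
  rw [List.mem_range'_1] at hi
  have hi' : i < n := by omega
  have e1 : P.1.testBit i = P'.1.testBit i := by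
    have := congrArg (fun x => Nat.testBit x i) h1
    simpa [Nat.testBit_mod_two_pow, hi'] using this
  have e2 : P.2.testBit i = P'.2.testBit i := by
    have := congrArg (fun x => Nat.testBit x i) h2
    simpa [Nat.testBit_mod_two_pow, hi'] using this
  rw [e1, e2]

/-! ## Digits -/

/-- The value of the digit `bitF p i`. -/
theorem bitF_val (p i : ℕ) : ((bitF p i : Fin 2) : ℕ) = p / 2 ^ i % 2 := by
  show (p.testBit i).toNat = _
  exact Nat.toNat_testBit p i

/-- The coercion of `bitF p i` to `ℕ` is `(p.testBit i).toNat`. -/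
theorem bitF_coe (p i : ℕ) : ((bitF p i : Fin 2) : ℕ) = (p.testBit i).toNat := rfl

/-- **Digit bookkeeping** (the transition rule of the carry automaton).  For `p < 2^{n+2}` and a carry
`κ ∈ {0,1}`: subtracting the level-`n` contribution `2^n v` from `p` leaves a number `< 2^{n+1}` with top digit `κ`
iff `v + κ = p_n + 2 p_{n+1}`. -/
theorem digit_iff (p n v : ℕ) (κ : Fin 2) (hp : p < 2 ^ (n + 1 + 1)) :
    (2 ^ n * v ≤ p ∧ p - 2 ^ n * v < 2 ^ (n + 1) ∧ bitF (p - 2 ^ n * v) n = κ) ↔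
      v + (κ : ℕ) = (p.testBit n).toNat + 2 * (p.testBit (n + 1)).toNat := by
  have h2n : 0 < 2 ^ n := by positivity
  have hM4 : p / 2 ^ n < 4 := by
    rw [Nat.div_lt_iff_lt_mul h2n]
    calc p < 2 ^ (n + 1 + 1) := hp
      _ = 4 * 2 ^ n := by ring
  have hbn : (p.testBit n).toNat = p / 2 ^ n % 2 := Nat.toNat_testBit p n
  have hbn1 : (p.testBit (n + 1)).toNat = p / 2 ^ n / 2 % 2 := by
    rw [Nat.toNat_testBit, pow_succ, ← Nat.div_div_eq_div_mul]
  have hA : 2 ^ n * v ≤ p ↔ v ≤ p / 2 ^ n := by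
    rw [Nat.le_div_iff_mul_le h2n, mul_comm]
  have hB : p - 2 ^ n * v < 2 ^ (n + 1) ↔ p / 2 ^ n - v < 2 := by
    rw [pow_succ, mul_comm (2 ^ n) 2, ← Nat.div_lt_iff_lt_mul h2n, Nat.sub_mul_div]
  have hC : (bitF (p - 2 ^ n * v) n = κ) ↔ (p / 2 ^ n - v) % 2 = (κ : ℕ) := by
    rw [Fin.ext_iff, bitF_val, Nat.sub_mul_div]
  rw [hA, hB, hC, hbn, hbn1]
  have hκ := κ.isLt
  generalize p / 2 ^ n = M at hM4 ⊢
  omega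

/-! ## Exponent vectors `single 0 p + single 1 q` -/

/-- First coordinate of `single 0 p + single 1 q`. -/
theorem pair_apply_zero (p q : ℕ) : (Finsupp.single (0 : Fin 2) p + Finsupp.single 1 q : Fin 2 →₀ ℕ) 0 = p := by
  simp

/-- Second coordinate of `single 0 p + single 1 q`. -/
theorem pair_apply_one (p q : ℕ) : (Finsupp.single (0 : Fin 2) p + Finsupp.single 1 q : Fin 2 →₀ ℕ) 1 = q := by
  simp

/-- A finitely supported function on `Fin 2` is `single 0 p + single 1 q` iff its two values are `p` and `q`. -/
theorem pair_eq_iff (f : Fin 2 →₀ ℕ) (p q : ℕ) :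
    f = Finsupp.single (0 : Fin 2) p + Finsupp.single 1 q ↔ f 0 = p ∧ f 1 = q := by
  constructor
  · rintro rfl
    exact ⟨pair_apply_zero p q, pair_apply_one p q⟩
  · rintro ⟨h0, h1⟩
    ext i
    fin_cases i
    · simpa [pair_apply_zero] using h0
    · simpa [pair_apply_one] using h1

/-- Coefficient of a product with a monomial `c · x^s y^t`: a shifted coefficient, or `0`. -/
theorem coeff_mul_pairMonomial (P : MvPolynomial (Fin 2) ℂ) (p q s t : ℕ) (c : ℂ) :
    coeff (Finsupp.single 0 p + Finsupp.single 1 q)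
        (P * monomial (Finsupp.single 0 s + Finsupp.single 1 t) c) =
      if s ≤ p ∧ t ≤ q then coeff (Finsupp.single 0 (p - s) + Finsupp.single 1 (q - t)) P * c else 0 := by
  rw [coeff_mul_monomial']
  have hle : (Finsupp.single (0 : Fin 2) s + Finsupp.single 1 t ≤ Finsupp.single 0 p + Finsupp.single 1 q) ↔
      s ≤ p ∧ t ≤ q := by
    rw [Finsupp.le_def, Fin.forall_fin_two, pair_apply_zero, pair_apply_zero, pair_apply_one, pair_apply_one]
  have hsub : Finsupp.single (0 : Fin 2) p + Finsupp.single 1 q - (Finsupp.single 0 s + Finsupp.single 1 t) =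
      Finsupp.single 0 (p - s) + Finsupp.single 1 (q - t) := by
    rw [pair_eq_iff]
    simp only [Finsupp.tsub_apply, pair_apply_zero, pair_apply_one, and_self]
  rw [hsub]
  simp only [hle]

/-! ## Expanding one level into its eight monomials -/

/-- The level-`i` factor expanded: `Σ_{u ∈ {0,1}³} (-a)^{u₁} (-b)^{u₂} (-g)^{u₃} x^{2^i (u₁+u₃)} y^{2^i (u₂+u₃)}`. -/
theorem hexFactor_expand (a b g : ℂ) (i : ℕ) :
    hexFactor a b g i = ∑ u : Fin 2 × Fin 2 × Fin 2,
      monomial (Finsupp.single 0 (2 ^ i * ((u.1 : ℕ) + u.2.2)) + Finsupp.single 1 (2 ^ i * ((u.2.1 : ℕ) + u.2.2)))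
        ((-a) ^ (u.1 : ℕ) * (-b) ^ (u.2.1 : ℕ) * (-g) ^ (u.2.2 : ℕ)) := by
  have key : ∀ u : Fin 2 × Fin 2 × Fin 2,
      monomial (Finsupp.single 0 (2 ^ i * ((u.1 : ℕ) + u.2.2)) + Finsupp.single 1 (2 ^ i * ((u.2.1 : ℕ) + u.2.2)))
        ((-a) ^ (u.1 : ℕ) * (-b) ^ (u.2.1 : ℕ) * (-g) ^ (u.2.2 : ℕ)) =
      C ((-a) ^ (u.1 : ℕ) * (-b) ^ (u.2.1 : ℕ) * (-g) ^ (u.2.2 : ℕ)) *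
        ((monomial (Finsupp.single (0 : Fin 2) (2 ^ i)) (1 : ℂ)) ^ (u.1 : ℕ) *
          (monomial (Finsupp.single (1 : Fin 2) (2 ^ i)) (1 : ℂ)) ^ (u.2.1 : ℕ) *
          (monomial (Finsupp.single (0 : Fin 2) (2 ^ i)) (1 : ℂ) *
            monomial (Finsupp.single (1 : Fin 2) (2 ^ i)) (1 : ℂ)) ^ (u.2.2 : ℕ)) := by
    intro u
    rw [monomial_mul, monomial_pow, monomial_pow, monomial_pow, monomial_mul, monomial_mul, C_mul_monomial]
    simp only [one_pow, mul_one]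
    have hs : (u.1 : ℕ) • Finsupp.single (0 : Fin 2) (2 ^ i) + (u.2.1 : ℕ) • Finsupp.single (1 : Fin 2) (2 ^ i) +
        (u.2.2 : ℕ) • (Finsupp.single (0 : Fin 2) (2 ^ i) + Finsupp.single (1 : Fin 2) (2 ^ i)) =
        Finsupp.single 0 (2 ^ i * ((u.1 : ℕ) + u.2.2)) + Finsupp.single 1 (2 ^ i * ((u.2.1 : ℕ) + u.2.2)) := by
      rw [pair_eq_iff]
      simp only [Finsupp.coe_add, Finsupp.coe_smul, Pi.add_apply, Pi.smul_apply, smul_eq_mul,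
        Finsupp.single_apply]
      simp
      constructor <;> ring
    rw [hs]
  rw [Finset.sum_congr rfl fun u _ => key u]
  unfold hexFactor
  rw [show (monomial (Finsupp.single (0 : Fin 2) (2 ^ i) + Finsupp.single 1 (2 ^ i))) (1 : ℂ) =
      monomial (Finsupp.single (0 : Fin 2) (2 ^ i)) (1 : ℂ) * monomial (Finsupp.single (1 : Fin 2) (2 ^ i)) (1 : ℂ) by
    rw [monomial_mul, one_mul]]
  simp only [Fintype.sum_prod_type, Fin.sum_univ_two, Fin.val_zero, Fin.val_one, pow_zero, pow_one, mul_one,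
    one_mul, map_one, map_mul, map_neg]
  ring

/-! ## The induction -/

/-- Base of the induction (`n = 0`): both sides are `[p = q = 0]`. -/
theorem base (a b g : ℕ → ℂ) (p q : ℕ) :
    coeff (Finsupp.single 0 p + Finsupp.single 1 q) (hexProd a b g 0) =
      if p < 2 ^ (0 + 1) ∧ q < 2 ^ (0 + 1) then hexN a b g 0 0 (p, q) (0, 0) (bitF p 0, bitF q 0) else 0 := by
  have h1 : hexProd a b g 0 = 1 := by simp [hexProd]
  have h2 : hexN a b g 0 0 (p, q) = 1 := by simp [hexN]
  rw [h1, h2, coeff_one, Matrix.one_apply]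
  have e1 : ((0 : Fin 2 →₀ ℕ) = Finsupp.single 0 p + Finsupp.single 1 q) ↔ p = 0 ∧ q = 0 := by
    rw [pair_eq_iff]
    simp [eq_comm]
  have e2 : (((0 : Fin 2), (0 : Fin 2)) = (bitF p 0, bitF q 0)) ↔ p % 2 = 0 ∧ q % 2 = 0 := by
    rw [Prod.mk.injEq, Fin.ext_iff, Fin.ext_iff, bitF_val, bitF_val]
    simp [eq_comm]
  simp only [e1, e2, zero_add, pow_one]
  split_ifs <;> first | rfl | (exfalso; omega)

/-- One term of the induction step (fixed level-`n` contribution `(v, v') = (u₁+u₃, u₂+u₃)` with weight `c`):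
the shifted, induction-hypothesis-evaluated coefficient equals the `u`-part of `(hexN · hexT)((0,0), top digits)`. -/
theorem step_term (a b g : ℕ → ℂ) (n p q : ℕ) (hp : p < 2 ^ (n + 1 + 1)) (hq : q < 2 ^ (n + 1 + 1)) (v v' : ℕ)
    (c : ℂ) :
    (if 2 ^ n * v ≤ p ∧ 2 ^ n * v' ≤ q then
        (if p - 2 ^ n * v < 2 ^ (n + 1) ∧ q - 2 ^ n * v' < 2 ^ (n + 1) then
            hexN a b g 0 n (p - 2 ^ n * v, q - 2 ^ n * v') (0, 0) (bitF (p - 2 ^ n * v) n, bitF (q - 2 ^ n * v') n)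
          else 0) * c
      else 0) =
    ∑ κ : St, hexN a b g 0 n (p, q) (0, 0) κ *
      (if v + (κ.1 : ℕ) = (p.testBit n).toNat + 2 * (p.testBit (n + 1)).toNat ∧
          v' + (κ.2 : ℕ) = (q.testBit n).toNat + 2 * (q.testBit (n + 1)).toNat then c else 0) := by
  by_cases hA : 2 ^ n * v ≤ p ∧ 2 ^ n * v' ≤ q
  · by_cases hB : p - 2 ^ n * v < 2 ^ (n + 1) ∧ q - 2 ^ n * v' < 2 ^ (n + 1)
    · rw [if_pos hA, if_pos hB]
      rw [hexN_congr a b g n (p - 2 ^ n * v, q - 2 ^ n * v') (p, q) (Nat.sub_mul_mod hA.1) (Nat.sub_mul_mod hA.2)]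
      rw [Finset.sum_eq_single (bitF (p - 2 ^ n * v) n, bitF (q - 2 ^ n * v') n)]
      · rw [if_pos]
        exact ⟨(digit_iff p n v _ hp).1 ⟨hA.1, hB.1, rfl⟩, (digit_iff q n v' _ hq).1 ⟨hA.2, hB.2, rfl⟩⟩
      · intro κ _ hne
        rw [if_neg, mul_zero]
        intro hc
        apply hne
        obtain ⟨-, -, e1⟩ := (digit_iff p n v κ.1 hp).2 hc.1
        obtain ⟨-, -, e2⟩ := (digit_iff q n v' κ.2 hq).2 hc.2
        exact Prod.ext e1.symm e2.symm
      · intro h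
        exact absurd (Finset.mem_univ _) h
    · rw [if_pos hA, if_neg hB, zero_mul]
      symm
      refine Finset.sum_eq_zero fun κ _ => ?_
      rw [if_neg, mul_zero]
      intro hc
      obtain ⟨-, h1, -⟩ := (digit_iff p n v κ.1 hp).2 hc.1
      obtain ⟨-, h2, -⟩ := (digit_iff q n v' κ.2 hq).2 hc.2
      exact hB ⟨h1, h2⟩
  · rw [if_neg hA]
    symm
    refine Finset.sum_eq_zero fun κ _ => ?_
    rw [if_neg, mul_zero]
    intro hc
    obtain ⟨h1, -, -⟩ := (digit_iff p n v κ.1 hp).2 hc.1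
    obtain ⟨h2, -, -⟩ := (digit_iff q n v' κ.2 hq).2 hc.2
    exact hA ⟨h1, h2⟩

/-- The induction step, assembled: the sum over the eight monomials of the top factor of the shifted coefficients
(already evaluated by the induction hypothesis) is the `((0,0), top digits)` entry of `hexN` over `n+1` levels. -/
theorem assemble (a b g : ℕ → ℂ) (n p q : ℕ) :
    (∑ u : Fin 2 × Fin 2 × Fin 2,
      if 2 ^ n * ((u.1 : ℕ) + u.2.2) ≤ p ∧ 2 ^ n * ((u.2.1 : ℕ) + u.2.2) ≤ q then
        (if p - 2 ^ n * ((u.1 : ℕ) + u.2.2) < 2 ^ (n + 1) ∧ q - 2 ^ n * ((u.2.1 : ℕ) + u.2.2) < 2 ^ (n + 1) then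
            hexN a b g 0 n (p - 2 ^ n * ((u.1 : ℕ) + u.2.2), q - 2 ^ n * ((u.2.1 : ℕ) + u.2.2)) (0, 0)
              (bitF (p - 2 ^ n * ((u.1 : ℕ) + u.2.2)) n, bitF (q - 2 ^ n * ((u.2.1 : ℕ) + u.2.2)) n)
          else 0) * ((-a n) ^ (u.1 : ℕ) * (-b n) ^ (u.2.1 : ℕ) * (-g n) ^ (u.2.2 : ℕ))
      else 0) =
    if p < 2 ^ (n + 1 + 1) ∧ q < 2 ^ (n + 1 + 1) then
      hexN a b g 0 (n + 1) (p, q) (0, 0) (bitF p (n + 1), bitF q (n + 1)) else 0 := by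
  split_ifs with h
  · rw [hexN_succ, Matrix.mul_apply]
    simp only [hexT, Finset.mul_sum]
    rw [Finset.sum_comm]
    refine Finset.sum_congr rfl fun u _ => ?_
    rw [step_term a b g n p q h.1 h.2]
    rfl
  · refine Finset.sum_eq_zero fun u _ => ?_
    have hu1 := u.1.isLt
    have hu2 := u.2.1.isLt
    have hu3 := u.2.2.isLt
    have h4 : 2 ^ (n + 1 + 1) = 4 * 2 ^ n := by ring
    have h2 : 2 ^ (n + 1) = 2 * 2 ^ n := by ring
    have hw : 2 ^ n * ((u.1 : ℕ) + u.2.2) ≤ 2 ^ n * 2 := Nat.mul_le_mul_left _ (by omega)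
    have hw' : 2 ^ n * ((u.2.1 : ℕ) + u.2.2) ≤ 2 ^ n * 2 := Nat.mul_le_mul_left _ (by omega)
    rw [not_and_or, not_lt, not_lt] at h
    rw [h4] at h
    rw [h2]
    generalize 2 ^ n * ((u.1 : ℕ) + u.2.2) = w at hw ⊢
    generalize 2 ^ n * ((u.2.1 : ℕ) + u.2.2) = w' at hw' ⊢
    generalize 2 ^ n = N at *
    split_ifs with hA hB
    · exfalso
      omega
    · simp
    · rfl

end AutoCoeffAux

open AutoCoeffAux

/-- **Automaton correctness.**  The coefficient of `x^p y^q` in the digit-hexagon product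
`hexProd a b g n = Π_{i<n} (1 - a_i x^{2^i}) (1 - b_i y^{2^i}) (1 - g_i (xy)^{2^i})` is, for `p, q < 2^{n+1}`,
the `((0,0), (p_n, q_n))` entry of the ordered product `hexN a b g 0 n (p, q)` of the carry transfer matrices, and
`0` beyond.  Induction on `n`: peel the top level (`hexProd_succ`, `hexN_succ`), expand it into its eight monomials
(`hexFactor_expand`), shift the coefficient (`coeff_mul_pairMonomial`), apply the induction hypothesis, and do the
digit bookkeeping (`step_term` / `digit_iff`). [folklore: carry automaton] -/
theorem stub_autoCoeff (a b g : ℕ → ℂ) (n p q : ℕ) :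
    coeff (Finsupp.single 0 p + Finsupp.single 1 q) (hexProd a b g n) =
      if p < 2 ^ (n + 1) ∧ q < 2 ^ (n + 1) then hexN a b g 0 n (p, q) (0, 0) (bitF p n, bitF q n) else 0 := by
  induction n generalizing p q with
  | zero => exact base a b g p q
  | succ n ih =>
    rw [hexProd_succ, hexFactor_expand, Finset.mul_sum, coeff_sum]
    have step1 : ∀ u : Fin 2 × Fin 2 × Fin 2,
        coeff (Finsupp.single 0 p + Finsupp.single 1 q) (hexProd a b g n *
          monomial (Finsupp.single 0 (2 ^ n * ((u.1 : ℕ) + u.2.2)) + Finsupp.single 1 (2 ^ n * ((u.2.1 : ℕ) + u.2.2)))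
            ((-a n) ^ (u.1 : ℕ) * (-b n) ^ (u.2.1 : ℕ) * (-g n) ^ (u.2.2 : ℕ))) =
        if 2 ^ n * ((u.1 : ℕ) + u.2.2) ≤ p ∧ 2 ^ n * ((u.2.1 : ℕ) + u.2.2) ≤ q then
          (if p - 2 ^ n * ((u.1 : ℕ) + u.2.2) < 2 ^ (n + 1) ∧ q - 2 ^ n * ((u.2.1 : ℕ) + u.2.2) < 2 ^ (n + 1) then
              hexN a b g 0 n (p - 2 ^ n * ((u.1 : ℕ) + u.2.2), q - 2 ^ n * ((u.2.1 : ℕ) + u.2.2)) (0, 0)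
                (bitF (p - 2 ^ n * ((u.1 : ℕ) + u.2.2)) n, bitF (q - 2 ^ n * ((u.2.1 : ℕ) + u.2.2)) n)
            else 0) * ((-a n) ^ (u.1 : ℕ) * (-b n) ^ (u.2.1 : ℕ) * (-g n) ^ (u.2.2 : ℕ))
        else 0 := fun u => by
      rw [coeff_mul_pairMonomial, ih]
    rw [Finset.sum_congr rfl fun u _ => step1 u]
    exact assemble a b g n p q

end Summit.ValiantsHypothesis.ValiantsHypothesis.Theorems.NewtonTauWeakAutomaton

end
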